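import Summits.ResolutionOfSingularities.ResolutionOfSingularities.Theorems.HomologicalConductorNoZenoLoopLemma
import HarnessLib

/-!
# Route `HomologicalConductor`, crux `NoZenoR` (stmt-ResolutionOfSingularities-19943): PERIODIC loop certificates

`[OURS · L W4.4]` Cell res-hironaka, crux chain W4.4 (lead prover res-L0-w44-lead-1 gen 5).  A two-lemma supplement to
`HomologicalConductorNoZenoLoopLemma.lean` (period one from stage `0`) and `SelfSimilar.tower_add_succ` (period one from stage `s`):
the receiver for a loop certificate of ARBITRARY PERIOD `q ≥ 1` starting at an ARBITRARY STAGE `m₀` — the shape an engine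
certificate actually has («stage `m₀ + q` is carried onto by `σ` from stage `m₀`», e.g. a period-two Nash loop first met after a
transient).  For a `k`-algebra automorphism `σ` of `K` with `σ(O) = O`:

* `tower_add_eq_map_of_periodic` — `T_(m₀+q) = σ T_(m₀)` ⇒ `T_(m₀+q+j) = σ T_(m₀+j)` for every `j` (the whole tower from `m₀` on is
  `q`-periodic up to `σ`; proof: `tower_map`-free induction on `j` via the one-step equivariance `SelfSimilar.step_map`).
* `no_regular_stage_of_periodic` — if moreover the `m₀ + q` stages `T_0, …, T_(m₀+q-1)` are singular, NO stage is regular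
  (strong induction: a regular `T_(m₀+q+j)` is ring-isomorphic to `T_(m₀+j)`), i.e. the datum refutes termination of the route's
  tower; with `PersistenceRadical` proved this is the typed kill path «certified loop ⇒ ¬(StrictDrop ∧ NoZenoR)».

Nothing here is a statement of the manuscript under review (Hironaka 2017); OURS; AI-written, weaker than expert review.
-/

-- single-problem summit: the doubled namespace component `ResolutionOfSingularities` is forced
set_option linter.dupNamespace false

noncomputable section

namespace Summit.ResolutionOfSingularities.ResolutionOfSingularities.Theorems.NoZeno.Loop

open Summit.ResolutionOfSingularities.ResolutionOfSingularities.Theorems.NoZeno.Birth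
open Summit.ResolutionOfSingularities.ResolutionOfSingularities.Theorems.StrictDrop.Negative (SelfSimilar.step_map)

variable {k K : Type} [Field k] [Field K] [Algebra k K]

/-- **Loops of any period propagate.** If stage `m₀ + q` is the `σ`-image of stage `m₀` (`σ(O) = O`), then
`T_(m₀+q+j) = σ T_(m₀+j)` for every `j`. [this work] -/
theorem tower_add_eq_map_of_periodic (O : ValuationSubring K) (σ : K ≃ₐ[k] K)
    (hO : ∀ x : K, σ x ∈ O ↔ x ∈ O) (A : Subalgebra k K) (m₀ q : ℕ)
    (hper : tower O A (m₀ + q) = (tower O A m₀).map (σ : K →ₐ[k] K)) (j : ℕ) :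
    tower O A (m₀ + q + j) = (tower O A (m₀ + j)).map (σ : K →ₐ[k] K) := by
  induction j with
  | zero => simpa using hper
  | succ j ih =>
      rw [← Nat.add_assoc, tower_succ O A (m₀ + q + j), ih, ← SelfSimilar.step_map O hO, ← tower_succ,
        Nat.add_assoc]

/-- **Periodic loop certificate ⇒ no regular stage.**  If `T_(m₀+q) = σ T_(m₀)` with `q ≥ 1`, `σ(O) = O`, and the stages
`T_0, …, T_(m₀+q-1)` (the transient and one period) are singular, then no stage of the tower is regular. [this work] -/
theorem no_regular_stage_of_periodic (O : ValuationSubring K) (σ : K ≃ₐ[k] K)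
    (hO : ∀ x : K, σ x ∈ O ↔ x ∈ O) (A : Subalgebra k K) (m₀ q : ℕ) (hq : 0 < q)
    (hper : tower O A (m₀ + q) = (tower O A m₀).map (σ : K →ₐ[k] K))
    (hsing : ∀ m : ℕ, m < m₀ + q → ¬ IsRegularLocalRing ↥(tower O A m)) :
    ¬ ∃ m : ℕ, IsRegularLocalRing ↥(tower O A m) := by
  rintro ⟨m, hm⟩
  induction m using Nat.strong_induction_on with
  | _ m ih =>
    by_cases hlt : m < m₀ + q
    · exact hsing m hlt hm
    · obtain ⟨j, rfl⟩ : ∃ j, m = m₀ + q + j := ⟨m - (m₀ + q), by omega⟩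
      -- stage `m₀ + j` and stage `m₀ + q + j` are isomorphic `k`-algebras via `σ`
      let e : ↥(tower O A (m₀ + j)) ≃ₐ[k] ↥(tower O A (m₀ + q + j)) :=
        (σ.subalgebraMap (tower O A (m₀ + j))).trans
          (Subalgebra.equivOfEq _ _ (tower_add_eq_map_of_periodic O σ hO A m₀ q hper j).symm)
      have hreg : IsRegularLocalRing ↥(tower O A (m₀ + j)) :=
        IsRegularLocalRing.of_ringEquiv (R := ↥(tower O A (m₀ + q + j))) e.symm.toRingEquiv
      exact ih (m₀ + j) (by omega) hreg

/-- **Periodic loop certificate, singularity checked on one period only.**  If `T_(m₀+q) = σ T_(m₀)` (`q ≥ 1`, `σ(O) = O`)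
and the `q` stages `T_(m₀), …, T_(m₀+q-1)` of one period are singular, then no stage `≥ m₀` is regular. [this work] -/
theorem no_regular_stage_ge_of_periodic (O : ValuationSubring K) (σ : K ≃ₐ[k] K)
    (hO : ∀ x : K, σ x ∈ O ↔ x ∈ O) (A : Subalgebra k K) (m₀ q : ℕ) (hq : 0 < q)
    (hper : tower O A (m₀ + q) = (tower O A m₀).map (σ : K →ₐ[k] K))
    (hsing : ∀ m : ℕ, m₀ ≤ m → m < m₀ + q → ¬ IsRegularLocalRing ↥(tower O A m)) :
    ∀ m : ℕ, m₀ ≤ m → ¬ IsRegularLocalRing ↥(tower O A m) := by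
  intro m
  induction m using Nat.strong_induction_on with
  | _ m ih =>
    intro hm₀ hm
    by_cases hlt : m < m₀ + q
    · exact hsing m hm₀ hlt hm
    · obtain ⟨j, rfl⟩ : ∃ j, m = m₀ + q + j := ⟨m - (m₀ + q), by omega⟩
      let e : ↥(tower O A (m₀ + j)) ≃ₐ[k] ↥(tower O A (m₀ + q + j)) :=
        (σ.subalgebraMap (tower O A (m₀ + j))).trans
          (Subalgebra.equivOfEq _ _ (tower_add_eq_map_of_periodic O σ hO A m₀ q hper j).symm)
      have hreg : IsRegularLocalRing ↥(tower O A (m₀ + j)) :=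
        IsRegularLocalRing.of_ringEquiv (R := ↥(tower O A (m₀ + q + j))) e.symm.toRingEquiv
      exact ih (m₀ + j) (by omega) (by omega) hreg

end Summit.ResolutionOfSingularities.ResolutionOfSingularities.Theorems.NoZeno.Loop

end
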